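import Summits.ResolutionOfSingularities.ResolutionOfSingularities.Theorems.PurelyInseparableDim4ResConeAlternation
import HarnessLib
import HarnessLib.Audit.Tags

/-!
# Purely inseparable four-folds — TT PROPAGATION: the «no passive kernel vector» frame condition persists along pair
# charts and across a pair move, by (I2) alone (K2(p) lane, SLICE C, TAIL-D residual bookkeeping for the hN4-D / hN4-C′
# owners; file-holder res-dim4-p-5 g4)

[OURS · counted 0 · cell `res-dim4-pi` · K2(p) lane, slice C (holder's TT question 06:34:06Z (4)) · seat p-5 g4.]
Nothing here proves K2(p)/K2(5), `NoIsolatedTrap p p`, TAIL-D or resolution of singularities in dimension ≥ 4 / char. `p`.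

On a constant-`(d, e_G)` tail, (I2) `…Alternation.chain_resVertex_step_inf_hyperplane_eq` says
`Vtx(k+1) ∩ H_{j k} = Vtx(k) ∩ H_{j k}`.  Call the kernel TT FOR THE PAIR `{a, a′}` at time `k` when it has no non-zero
vector vanishing at `a` and `a′` (it then projects isomorphically onto `⟨e_a, e_{a′}⟩`: a tilted frame
`⟨e_a + φ, e_{a′} + ψ⟩` exists).  FT-free consequences, every `p`, `d`, `e_G`:
* `exists_tt_pair_of_finrank_eq_two` — some pair is always TT (linear algebra);
* `mem_resVertex_iff_of_apply_chart_eq_zero` — a vector vanishing at the chart letter is a kernel vector after the step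
  iff before;
* **`tt_succ_of_apply_chart`** — TT for `{a,a′}` at `k` ⇒ at `k+1` no non-zero kernel vector vanishes on `{j k, a, a′}`;
  in particular (`tt_succ`, `tt_run`) TT PERSISTS along steps charted in the pair;
* **`tt_move`** — across a PAIR MOVE (chart `g ∉ {a,a′}` at a TT time, frame vector `e_a + φ ∈ Vtx(k)` with `φ_g ≠ 0`):
  TT for the NEW pair `{g, a′}` at `k+1` (symmetrically `{g, a}` from `e_{a′} + ψ`, `ψ_g ≠ 0`).
So TT has to be established ONCE on a tail (the circularity in `…LossyPairTail.no_passive_kernel_vector`, which uses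
FT and the pair hypothesis on the whole future, is only at ENTRY).
[cite: CossartJannsenSaito2020, Thm. 3.10(4), Thm. 3.14, Thm. 9.3]
bears_on: LADDER-RESOLUTION:D157-DOOR2 (res-dim4-pi · K2(p) = `RidgeBudget.NoAboveFloorTrap p p` · slice C, TAIL-D presentation residuals).
Supports stmt-ResolutionOfSingularities-16155 (helper).
-/

set_option linter.dupNamespace false -- mandated namespace of this single-conjunct summit

noncomputable section

namespace Summit.ResolutionOfSingularities.ResolutionOfSingularities.Theorems.PIDim4

namespace ResCone

open MvPolynomial Finset
open Literature.AlgebraicGeometry.Resolution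
open Literature.AlgebraicGeometry.Resolution.CentreBlowup
open Literature.AlgebraicGeometry.Resolution.Hauser2010
open Literature.AlgebraicGeometry.Resolution.HauserPerlega2019

variable {K : Type} [Field K]

section SomePair

/-- **SOME PAIR IS ALWAYS TT**: a `2`-dimensional subspace of `K⁴` has two coordinates onto which it projects
isomorphically — no non-zero vector of it vanishes at both (a rank-`2` matrix has an invertible `2 × 2` minor; here by
hand: kernel vectors supported on `{2,3}` and on `{0,1}` would give, with a third one, three independent vectors).
[folklore] -/
theorem exists_tt_pair_of_finrank_eq_two {V : Submodule K (Fin 4 → K)} (hV : Module.finrank K V = 2) :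
    ∃ x y : Fin 4, x ≠ y ∧ ∀ v ∈ V, v x = 0 → v y = 0 → v = 0 := by
  classical
  by_contra hno
  push Not at hno
  -- a kernel vector supported on {2,3} and one supported on {0,1}
  obtain ⟨v₁, hv₁, h10, h11, hv₁0⟩ := hno 0 1 (by decide)
  obtain ⟨v₂, hv₂, h22, h23, hv₂0⟩ := hno 2 3 (by decide)
  -- a non-zero coordinate of each
  have hex₁ : ∃ y : Fin 4, (y = 2 ∨ y = 3) ∧ v₁ y ≠ 0 := by
    by_contra h
    push Not at h
    refine hv₁0 (funext fun i => ?_)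
    fin_cases i
    · exact h10
    · exact h11
    · exact h 2 (Or.inl rfl)
    · exact h 3 (Or.inr rfl)
  have hex₂ : ∃ x : Fin 4, (x = 0 ∨ x = 1) ∧ v₂ x ≠ 0 := by
    by_contra h
    push Not at h
    refine hv₂0 (funext fun i => ?_)
    fin_cases i
    · exact h 0 (Or.inl rfl)
    · exact h 1 (Or.inr rfl)
    · exact h22
    · exact h23
  obtain ⟨y, hy, hv₁y⟩ := hex₁
  obtain ⟨x, hx, hv₂x⟩ := hex₂
  have hv₁x : v₁ x = 0 := by rcases hx with rfl | rfl <;> assumption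
  have hv₂y : v₂ y = 0 := by rcases hy with rfl | rfl <;> assumption
  have hxy : x ≠ y := by rintro rfl; exact hv₁y hv₁x
  obtain ⟨v₃, hv₃, h3x, h3y, hv₃0⟩ := hno x y hxy
  -- three vectors in a plane are dependent
  have hdep : ¬ LinearIndependent K ![(⟨v₁, hv₁⟩ : V), ⟨v₂, hv₂⟩, ⟨v₃, hv₃⟩] := by
    intro hli
    have := hli.fintype_card_le_finrank
    rw [Fintype.card_fin, hV] at this
    omega
  rw [Fintype.not_linearIndependent_iff] at hdep
  obtain ⟨g, hg, i, hgi⟩ := hdep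
  rw [Fin.sum_univ_three] at hg
  have hg' := congrArg (fun w : V => (w : Fin 4 → K)) hg
  simp only [Submodule.coe_add, Submodule.coe_smul, Matrix.cons_val_zero, Matrix.cons_val_one,
    Matrix.cons_val_two, Matrix.tail_cons, Matrix.head_cons, Submodule.coe_zero] at hg'
  -- read the relation at `x` and at `y`
  have hgx := congrFun hg' x
  have hgy := congrFun hg' y
  simp only [Pi.add_apply, Pi.smul_apply, smul_eq_mul, Pi.zero_apply, hv₁x, h3x, hv₂y, h3y, mul_zero, add_zero,
    zero_add] at hgx hgy
  -- hgx : g 1 * v₂ x = 0, hgy : g 0 * v₁ y = 0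
  have hg1 : g 1 = 0 := (mul_eq_zero.mp hgx).resolve_right hv₂x
  have hg0 : g 0 = 0 := (mul_eq_zero.mp hgy).resolve_right hv₁y
  have hg2 : g 2 ≠ 0 := by
    fin_cases i
    · exact absurd hg0 hgi
    · exact absurd hg1 hgi
    · exact hgi
  rw [hg0, hg1, zero_smul, zero_smul, zero_add, zero_add] at hg'
  exact hv₃0 ((smul_eq_zero.mp hg').resolve_left hg2)

end SomePair

section TTPersist

variable (p : ℕ) [Fact p.Prime] [DecidableEq K]

/-- **(I2) on vectors**: a vector vanishing at the chart letter `j k` is a kernel vector at `k + 1` iff it is one at `k`.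
[OURS · bookkeeping] [cite: CossartJannsenSaito2020, Thm. 3.10(4), Thm. 9.3] -/
theorem mem_resVertex_iff_of_apply_chart_eq_zero {c : ℕ → State K} {j : ℕ → Fin 4} {b : ℕ → Fin 4 → K}
    (hc : ∀ k, IsIsolated p (c k).F ∧ Step0 p (c k) (c (k + 1))) (hw : FreeTail.IsWitnessedChain p c j b)
    (hr0 : ∀ e ∈ (c 0).F.support, (c 0).r ≤ e) (hfloor : ∀ k, ordZero (c k).F ≠ p) {k₀ : ℕ} {d : ℕ∞}
    (hshade : ∀ k, k₀ ≤ k → (c k).shade = d) {e : ℕ} (he : ∀ k, k₀ ≤ k → Module.finrank K (resVertex (c k)) = e)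
    {k : ℕ} (hk : k₀ ≤ k) {w : Fin 4 → K} (hwj : w (j k) = 0) :
    w ∈ resVertex (c (k + 1)) ↔ w ∈ resVertex (c k) := by
  have hI2 := chain_resVertex_step_inf_hyperplane_eq p hc hw hr0 hfloor hshade he hk
  constructor
  · intro h
    have hmem : w ∈ resVertex (c (k + 1)) ⊓ hyperplane (j k) := Submodule.mem_inf.mpr ⟨h, mem_hyperplane.mpr hwj⟩
    rw [hI2] at hmem
    exact (Submodule.mem_inf.mp hmem).1
  · intro h
    have hmem : w ∈ resVertex (c k) ⊓ hyperplane (j k) := Submodule.mem_inf.mpr ⟨h, mem_hyperplane.mpr hwj⟩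
    rw [← hI2] at hmem
    exact (Submodule.mem_inf.mp hmem).1

/-- **TT PERSISTS THROUGH ONE STEP, in the strong form**: if no non-zero kernel vector at `k` vanishes on `{a, a′}`, then
no non-zero kernel vector at `k + 1` vanishes on `{j k, a, a′}` — whatever the chart letter `j k`. [OURS]
[cite: CossartJannsenSaito2020, Thm. 3.10(4), Thm. 9.3] -/
theorem tt_succ_of_apply_chart {c : ℕ → State K} {j : ℕ → Fin 4} {b : ℕ → Fin 4 → K}
    (hc : ∀ k, IsIsolated p (c k).F ∧ Step0 p (c k) (c (k + 1))) (hw : FreeTail.IsWitnessedChain p c j b)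
    (hr0 : ∀ e ∈ (c 0).F.support, (c 0).r ≤ e) (hfloor : ∀ k, ordZero (c k).F ≠ p) {k₀ : ℕ} {d : ℕ∞}
    (hshade : ∀ k, k₀ ≤ k → (c k).shade = d) {e : ℕ} (he : ∀ k, k₀ ≤ k → Module.finrank K (resVertex (c k)) = e)
    {a a' : Fin 4} {k : ℕ} (hk : k₀ ≤ k) (hTT : ∀ v ∈ resVertex (c k), v a = 0 → v a' = 0 → v = 0) :
    ∀ v ∈ resVertex (c (k + 1)), v (j k) = 0 → v a = 0 → v a' = 0 → v = 0 := fun v hv hvj hva hva' =>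
  hTT v ((mem_resVertex_iff_of_apply_chart_eq_zero p hc hw hr0 hfloor hshade he hk hvj).mp hv) hva hva'

/-- **TT PERSISTS ALONG A PAIR CHART**: TT for `{a, a′}` at `k` and `j k ∈ {a, a′}` ⇒ TT for `{a, a′}` at `k + 1`. [OURS]
[cite: CossartJannsenSaito2020, Thm. 3.10(4), Thm. 9.3] -/
theorem tt_succ {c : ℕ → State K} {j : ℕ → Fin 4} {b : ℕ → Fin 4 → K}
    (hc : ∀ k, IsIsolated p (c k).F ∧ Step0 p (c k) (c (k + 1))) (hw : FreeTail.IsWitnessedChain p c j b)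
    (hr0 : ∀ e ∈ (c 0).F.support, (c 0).r ≤ e) (hfloor : ∀ k, ordZero (c k).F ≠ p) {k₀ : ℕ} {d : ℕ∞}
    (hshade : ∀ k, k₀ ≤ k → (c k).shade = d) {e : ℕ} (he : ∀ k, k₀ ≤ k → Module.finrank K (resVertex (c k)) = e)
    {a a' : Fin 4} {k : ℕ} (hk : k₀ ≤ k) (hTT : ∀ v ∈ resVertex (c k), v a = 0 → v a' = 0 → v = 0)
    (hj : j k = a ∨ j k = a') : ∀ v ∈ resVertex (c (k + 1)), v a = 0 → v a' = 0 → v = 0 := by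
  intro v hv hva hva'
  refine tt_succ_of_apply_chart p hc hw hr0 hfloor hshade he hk hTT v hv ?_ hva hva'
  rcases hj with h | h <;> rw [h]
  · exact hva
  · exact hva'

/-- **TT PERSISTS ALONG A RUN OF PAIR CHARTS**: TT for `{a, a′}` at `k` and charts in `{a, a′}` on `[k, m)` ⇒ TT at every
time in `[k, m]`. [OURS] [cite: CossartJannsenSaito2020, Thm. 3.10(4), Thm. 9.3] -/
theorem tt_run {c : ℕ → State K} {j : ℕ → Fin 4} {b : ℕ → Fin 4 → K}
    (hc : ∀ k, IsIsolated p (c k).F ∧ Step0 p (c k) (c (k + 1))) (hw : FreeTail.IsWitnessedChain p c j b)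
    (hr0 : ∀ e ∈ (c 0).F.support, (c 0).r ≤ e) (hfloor : ∀ k, ordZero (c k).F ≠ p) {k₀ : ℕ} {d : ℕ∞}
    (hshade : ∀ k, k₀ ≤ k → (c k).shade = d) {e : ℕ} (he : ∀ k, k₀ ≤ k → Module.finrank K (resVertex (c k)) = e)
    {a a' : Fin 4} {k m : ℕ} (hk : k₀ ≤ k) (hTT : ∀ v ∈ resVertex (c k), v a = 0 → v a' = 0 → v = 0)
    (hrun : ∀ t, k ≤ t → t < m → (j t = a ∨ j t = a')) :
    ∀ t, k ≤ t → t ≤ m → ∀ v ∈ resVertex (c t), v a = 0 → v a' = 0 → v = 0 := by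
  intro t hkt htm
  induction t, hkt using Nat.le_induction with
  | base => exact hTT
  | succ t hkt ih => exact tt_succ p hc hw hr0 hfloor hshade he (by omega) (ih (by omega)) (hrun t hkt (by omega))

/-- **TT ACROSS A PAIR MOVE**: TT for `{a, a′}` at `k`, a frame vector `e_a + φ ∈ Vtx(k)` (`φ_a = φ_{a′} = 0`) whose
tilt at the letter `g` is non-zero, and the chart `j k = g` ⇒ TT for the NEW pair `{g, a′}` at `k + 1`: a kernel vector
`v` with `v_g = v_{a′} = 0` is an old kernel vector ((I2)), `v − v_a (e_a + φ)` vanishes on `{a, a′}` hence is `0`, and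
then `0 = v_g = v_a φ_g` forces `v_a = 0`. [OURS] [cite: CossartJannsenSaito2020, Thm. 3.10(4), Thm. 3.14, Thm. 9.3] -/
theorem tt_move {c : ℕ → State K} {j : ℕ → Fin 4} {b : ℕ → Fin 4 → K}
    (hc : ∀ k, IsIsolated p (c k).F ∧ Step0 p (c k) (c (k + 1))) (hw : FreeTail.IsWitnessedChain p c j b)
    (hr0 : ∀ e ∈ (c 0).F.support, (c 0).r ≤ e) (hfloor : ∀ k, ordZero (c k).F ≠ p) {k₀ : ℕ} {d : ℕ∞}
    (hshade : ∀ k, k₀ ≤ k → (c k).shade = d) {e : ℕ} (he : ∀ k, k₀ ≤ k → Module.finrank K (resVertex (c k)) = e)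
    {a a' g : Fin 4} (hga : g ≠ a) {k : ℕ} (hk : k₀ ≤ k)
    (hTT : ∀ v ∈ resVertex (c k), v a = 0 → v a' = 0 → v = 0)
    {φ : Fin 4 → K} (hφa : φ a = 0) (hφa' : φ a' = 0) (hφV : (Pi.single a 1 : Fin 4 → K) + φ ∈ resVertex (c k))
    (hφg : φ g ≠ 0) (hjg : j k = g) :
    ∀ v ∈ resVertex (c (k + 1)), v g = 0 → v a' = 0 → v = 0 := by
  intro v hv hvg hva'
  have hv0 : v ∈ resVertex (c k) :=
    (mem_resVertex_iff_of_apply_chart_eq_zero p hc hw hr0 hfloor hshade he hk (by rw [hjg]; exact hvg)).mp hv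
  set w : Fin 4 → K := v - v a • ((Pi.single a 1 : Fin 4 → K) + φ) with hwdef
  have hwV : w ∈ resVertex (c k) := Submodule.sub_mem _ hv0 (Submodule.smul_mem _ _ hφV)
  have hwa : w a = 0 := by
    simp only [hwdef, Pi.sub_apply, Pi.smul_apply, Pi.add_apply, Pi.single_eq_same, hφa, add_zero, smul_eq_mul,
      mul_one, sub_self]
  have hwa' : w a' = 0 := by
    by_cases haa : a' = a
    · rw [haa]; exact hwa
    · simp only [hwdef, Pi.sub_apply, Pi.smul_apply, Pi.add_apply, Pi.single_eq_of_ne haa, hφa', add_zero,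
        smul_eq_mul, mul_zero, sub_zero, hva']
  have hw0 := hTT w hwV hwa hwa'
  have hg : w g = 0 - v a * φ g := by
    simp only [hwdef, Pi.sub_apply, Pi.smul_apply, Pi.add_apply, Pi.single_eq_of_ne hga, zero_add, smul_eq_mul, hvg]
  rw [hw0, Pi.zero_apply, zero_sub, eq_comm, neg_eq_zero, mul_eq_zero] at hg
  have hva : v a = 0 := hg.resolve_right hφg
  have : v = w := by rw [hwdef, hva, zero_smul, sub_zero]
  rw [this, hw0]

end TTPersist

end ResCone

end Summit.ResolutionOfSingularities.ResolutionOfSingularities.Theorems.PIDim4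

end
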